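import Summits.BirchSwinnertonDyer.BirchSwinnertonDyer.Theses.SignedBaseChange
import Summits.BirchSwinnertonDyer.BirchSwinnertonDyer.Theorems.SignedBaseChangeTwistPairGreenbergProductDivisibilityStubFrameDataBCSSplit
import Summits.BirchSwinnertonDyer.BirchSwinnertonDyer.Theorems.SignedBaseChangeTwistPairGreenbergProductDivisibilityCanonicalFrameData
import Summits.BirchSwinnertonDyer.BirchSwinnertonDyer.Theorems.SignedBaseChangeK2RFrames
import Summits.BirchSwinnertonDyer.BirchSwinnertonDyer.Theorems.SignedBaseChangeK2RMuZero
import Summits.BirchSwinnertonDyer.Rank1Residual.Additive.QuadraticTwistSurj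
import Literature.NumberTheory.IwasawaTheory.IwasawaAlgebraTwoVarRegularProofs
import HarnessLib

/-!
# K1′ `TwistPairGreenbergProductDivisibilitySplit` (stmt-BirchSwinnertonDyer-20502), line `acanchor` of the
# crux-strategist (registered 2026-08-27T13:03Z): the composition and its algebra as THEOREMS, and the split of
# the load-bearing stub (route SignedBaseChange; helper `--supports` 20502; lead sbc-p1 g4)

Line `acanchor` ("anticyclotomic anchor + deformation rigidity", `Cruxes/…/Lines/acanchor.lean`
7de0af277ca038dc, card `Lines/acanchor.md`): PER FACTOR (`E/K` and `E^{(d)}/K`), the two-variable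
EULER-SYSTEM inclusion (ES) `(G) ⊆ ch(X_Gr₂)·𝒪_{ℂ_p}⟦T₁,T₂⟧`, the ANTICYCLOTOMIC ANCHOR (AC) on the line `T₁ = 0`
(`ch|_{T₁=0} ⊆ (G⁻)` and `G⁻ ≠ 0`), principality of characteristic ideals over `Λ_K = ℤ_p⟦T₁⟧⟦T₂⟧` (UFD) and the
rigidity lemma (`G = c·h`, `c(0,·) = G(0,·)·m`, `G(0,·) ≠ 0` ⇒ `h(0,·)·m = 1` ⇒ `h` a unit ⇒ `(c) = (G)`) give
the integral Eisenstein inclusion per factor, and K1′ with slack `s = 1`.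

THIS FILE lands, as citable sorry-free theorems (the `Cruxes/` skeleton carries the two `sorry` stubs and is not
importable as a theorem source):
* §1 the algebra (strategist's proofs, verbatim): `charIdealIsPrincipal₂`, `le_span_of_anchor`,
  `map_le_span_of_anchor`, `span_C_one_mul_mul_le`;
* §2 the twist transport: `surj_of_smul_eq_quadraticTwist`, `heegner_twist`;
* §3 the lead's SPLIT of the load-bearing stub AC = ACμ ∧ ACdiv, with ACμ (`G⁻ ≠ 0`, Hsieh's `μ = 0` in frame
  form) CLOSED BY NAME modulo ONE refereed named fact, the GUARDED Burungale–Castella–Skinner 2025 Prop. 4.2.2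
  `BurungaleCastellaSkinner2025.prop422_greenbergAnyRoot_hasUnitContent_minus` (`acMu_of_prop422`; pattern of
  sbc-p2's p526821 — NOT the card's v1 `prop422_grHalf_hasUnitContent_minus`, which its own file refutes on a
  degenerate frame), and the trivial reassembly `ac_of_acMu_of_acDiv`;
* §4 the composition with the stubs as explicit HYPOTHESES (texts VERBATIM = the registered signatures):
  `twistPairGreenbergProductDivisibilitySplit_of_eulerSystem_of_anchor : ES → AC → K1′` and
  `…_of_eulerSystem_of_acMu_of_acDiv : ES → ACμ → ACdiv → K1′`, hence
  `…_of_eulerSystem_of_acDiv_of_prop422 : prop422(v2) → ES → ACdiv → K1′` — the line's residual is exactly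
  (ES: the integral two-variable Euler-system inclusion; ACdiv: the anticyclotomic Eisenstein inclusion on
  `T₁ = 0` at a supersingular prime for additive level = the card's kernel G2″) plus one refereed named fact.
Nothing here asserts ES, AC or the conjectures behind them. No new definitions.
-/

-- D-0017: single-problem summit, the namespace repeats the problem name by design.
set_option linter.dupNamespace false
set_option autoImplicit false

noncomputable section

namespace Summit.BirchSwinnertonDyer.BirchSwinnertonDyer.Theorems.SignedBaseChangeK1Acanchor

open Summit.BirchSwinnertonDyer.BirchSwinnertonDyer.Theses.SignedBaseChange
open Literature.NumberTheory.EllipticCurves Literature.NumberTheory.EllipticCurves.ModularForms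
  Literature.NumberTheory.EllipticCurves.BurungaleSkinnerTianWan2024
  Literature.NumberTheory.GaloisRepresentations

/-! ## §1 Algebra: principality over `Λ_K` and deformation rigidity off the anticyclotomic line -/

/-- **Principality of characteristic ideals over `Λ_K = ℤ_p⟦T₁⟧⟦T₂⟧`.** The tree's `Module.charIdeal` is a
`finprod` of powers of height-one primes; `IwasawaAlgebra₂ p = (ℤ_[p]⟦T⟧)⟦T⟧` is factorial
(`Literature.NumberTheory.IwasawaTheory.uniqueFactorizationMonoid_powerSeries_powerSeries`), and height-one
primes of a UFD are principal. (Strategist's `charIdealIsPrincipal₂`, proof verbatim.) -/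
theorem charIdealIsPrincipal₂ (p : ℕ) [Fact p.Prime] (M : Type) [AddCommGroup M]
    [Module (IwasawaAlgebra₂ p) M] :
    (Literature.NumberTheory.EllipticCurves.Module.charIdeal (IwasawaAlgebra₂ p) M).IsPrincipal := by
  haveI : UniqueFactorizationMonoid (IwasawaAlgebra₂ p) :=
    Literature.NumberTheory.IwasawaTheory.uniqueFactorizationMonoid_powerSeries_powerSeries ℤ_[p]
  unfold Module.charIdeal
  rw [← Ideal.mem_isPrincipalSubmonoid_iff]
  refine finprod_mem_induction (· ∈ Ideal.isPrincipalSubmonoid (IwasawaAlgebra₂ p))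
    (Submonoid.one_mem _) (fun _ _ hx hy => Submonoid.mul_mem _ hx hy) ?_
  intro 𝔭 h𝔭
  refine Submonoid.pow_mem _ ?_ _
  obtain ⟨g, hg⟩ := UniqueFactorizationMonoid.isPrincipal_of_height_eq_one h𝔭
  rw [hg]
  exact Ideal.span_singleton_mem_isPrincipalSubmonoid g

/-- **Rigidity.** Over a domain `R`, in `R⟦T₂⟧⟦T₁⟧ = PowerSeries (PowerSeries R)` (outer variable `T₁`):
if `I = (c)` is principal, `G ∈ I`, the image of `I` under `T₁ ↦ 0` lies in `(G(0,·))` and `G(0,·) ≠ 0`,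
then `I ⊆ (G)`: `G = c·h`, `c(0,·) = G(0,·)·m` forces `m·h(0,·) = 1`, so `h` is a unit
(`PowerSeries.isUnit_iff_constantCoeff`). (Strategist's `le_span_of_anchor`, proof verbatim.) -/
theorem le_span_of_anchor {R : Type*} [CommRing R] [IsDomain R]
    {I : Ideal (PowerSeries (PowerSeries R))} {G : PowerSeries (PowerSeries R)}
    (hI : I.IsPrincipal) (hG : G ∈ I)
    (hanch : I.map (PowerSeries.constantCoeff (R := PowerSeries R)) ≤
      Ideal.span {PowerSeries.constantCoeff (R := PowerSeries R) G})
    (hne : PowerSeries.constantCoeff (R := PowerSeries R) G ≠ 0) :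
    I ≤ Ideal.span {G} := by
  obtain ⟨⟨c, hc⟩⟩ := hI
  have hc' : I = Ideal.span {c} := hc
  subst hc'
  obtain ⟨h, hGh⟩ := Ideal.mem_span_singleton.mp hG
  subst hGh
  have hcm : PowerSeries.constantCoeff (R := PowerSeries R) c ∈
      Ideal.span {PowerSeries.constantCoeff (R := PowerSeries R) (c * h)} :=
    hanch (Ideal.mem_map_of_mem _ (Ideal.mem_span_singleton_self c))
  obtain ⟨m, hm⟩ := Ideal.mem_span_singleton.mp hcm
  rw [map_mul] at hm hne
  have hc0 : PowerSeries.constantCoeff (R := PowerSeries R) c ≠ 0 := left_ne_zero_of_mul hne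
  have h1 : PowerSeries.constantCoeff (R := PowerSeries R) h * m = 1 :=
    mul_left_cancel₀ hc0 (by rw [← mul_assoc, ← hm, mul_one])
  have hu : IsUnit h := PowerSeries.isUnit_iff_constantCoeff.mpr (IsUnit.of_mul_eq_one m h1)
  exact Ideal.span_singleton_le_span_singleton.mpr ⟨↑hu.unit⁻¹, by rw [mul_assoc, IsUnit.mul_val_inv, mul_one]⟩

/-- **Rigidity in K1′'s receptacle.** For a principal ideal `I ⊆ Λ_K` and a structure map `J`: the
Euler-system inclusion `(G) ⊆ I·𝒪⟦T₁,T₂⟧`, the anticyclotomic anchor `(I·𝒪⟦T₁,T₂⟧)|_{T₁=0} ⊆ (G⁻)` and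
`G⁻ ≠ 0` give the integral Eisenstein inclusion `I·𝒪⟦T₁,T₂⟧ ⊆ (G)`. (Strategist's `map_le_span_of_anchor`.) -/
theorem map_le_span_of_anchor {p : ℕ} [Fact p.Prime] {I : Ideal (IwasawaAlgebra₂ p)} (hI : I.IsPrincipal)
    (J : ℤ_[p] →+* PadicComplexInt p) {G : PowerSeries (PowerSeries (PadicComplexInt p))}
    (hES : Ideal.span {G} ≤ I.map (IwasawaAlgebra₂.toUnr₂ p J))
    (hne : UnrSeries₂.minus G ≠ 0)
    (hanch : (I.map (IwasawaAlgebra₂.toUnr₂ p J)).map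
        (PowerSeries.constantCoeff (R := PowerSeries (PadicComplexInt p))) ≤
      Ideal.span {UnrSeries₂.minus G}) :
    I.map (IwasawaAlgebra₂.toUnr₂ p J) ≤ Ideal.span {G} := by
  have hP : (I.map (IwasawaAlgebra₂.toUnr₂ p J)).IsPrincipal := by
    obtain ⟨⟨c, hc⟩⟩ := hI
    have hc' : I = Ideal.span {c} := hc
    refine ⟨⟨IwasawaAlgebra₂.toUnr₂ p J c, ?_⟩⟩
    rw [hc', Ideal.map_span, Set.image_singleton]
  exact le_span_of_anchor hP (hES (Ideal.mem_span_singleton_self G)) hanch hne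

/-- The product step with slack `s = 1`: `(C(1))·(A·B) ⊆ (G·G')` from `A ⊆ (G)`, `B ⊆ (G')`. -/
theorem span_C_one_mul_mul_le {p : ℕ} [Fact p.Prime]
    {A B : Ideal (PowerSeries (PowerSeries (PadicComplexInt p)))}
    {G G' : PowerSeries (PowerSeries (PadicComplexInt p))}
    (hA : A ≤ Ideal.span {G}) (hB : B ≤ Ideal.span {G'}) :
    Ideal.span {PowerSeries.map (PowerSeries.C (R := PadicComplexInt p)) 1} * (A * B) ≤
      Ideal.span {G * G'} := by
  rw [map_one, Ideal.span_singleton_one, Ideal.top_mul, ← Ideal.span_singleton_mul_span_singleton]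
  exact Ideal.mul_mono hA hB

/-! ## §2 The twist `W'` of the package inherits the per-factor hypotheses -/

/-- **Surjectivity of `ρ̄_{E,p}` passes to the twist `W'` of the package** (in-tree
`Summit.BirchSwinnertonDyer.Rank1Residual.Additive.surj_iff_of_model_twist`). -/
theorem surj_of_smul_eq_quadraticTwist (W W' : WeierstrassCurve ℚ) [W.IsElliptic] [W'.IsElliptic]
    (p : ℕ) [Fact p.Prime] {d : ℤ} {C : WeierstrassCurve.VariableChange ℚ} (hd : 1 < d)
    (hC : C • W' = W.quadraticTwist (d : ℚ))
    (hs : Literature.NumberTheory.EllipticCurves.Rank1Residual.Surj W p) :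
    Literature.NumberTheory.EllipticCurves.Rank1Residual.Surj W' p := by
  have hd0 : (d : ℚ) ≠ 0 := by exact_mod_cast (show d ≠ 0 by omega)
  exact (Summit.BirchSwinnertonDyer.Rank1Residual.Additive.surj_iff_of_model_twist W p hd0
    ⟨C⁻¹, by rw [← hC, inv_smul_smul]⟩).mpr hs

/-- **Heegner for the twist conductor.** If `C • W' = W^{(d)}`, every prime of `N = N_W` splits in `K`,
every prime of `d` splits in `K` and `2` splits in `K`, then every prime of `N' = N_{W'}` splits in `K`.
(Strategist's `heegner_twist`, proof verbatim; uses K2R's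
`hasGoodReductionAtPrime_of_smul_eq_quadraticTwist_of_not_ramifiedInQuadratic`.) -/
theorem heegner_twist (W W' : WeierstrassCurve ℚ) [W.IsElliptic] [W.IsGloballyMinimal] [W'.IsElliptic]
    [W'.IsGloballyMinimal] {d : ℤ} {C : WeierstrassCurve.VariableChange ℚ}
    (hC : C • W' = W.quadraticTwist (d : ℚ)) {N N' : ℕ} (hN : (N : ℤ) = W.conductorNorm ℤ)
    (hN' : (N' : ℤ) = W'.conductorNorm ℤ) {K : Type} [Field K] [NumberField K]
    (hHeeg : ∀ ℓ : ℕ, ℓ.Prime → ℓ ∣ N →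
      ((Ideal.span {(ℓ : ℤ)}).primesOver (NumberField.RingOfIntegers K)).ncard = 2)
    (hd : ∀ ℓ : ℕ, ℓ.Prime → (ℓ : ℤ) ∣ d →
      ((Ideal.span {(ℓ : ℤ)}).primesOver (NumberField.RingOfIntegers K)).ncard = 2)
    (h2 : ((Ideal.span {(2 : ℤ)}).primesOver (NumberField.RingOfIntegers K)).ncard = 2) :
    ∀ ℓ : ℕ, ℓ.Prime → ℓ ∣ N' →
      ((Ideal.span {(ℓ : ℤ)}).primesOver (NumberField.RingOfIntegers K)).ncard = 2 := by
  intro ℓ hℓ hℓN'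
  haveI : Fact ℓ.Prime := ⟨hℓ⟩
  have hN'n : N' = W'.conductorNorm ℤ := by exact_mod_cast hN'
  have hbad : ¬ W'.HasGoodReductionAtPrime ℓ :=
    (W'.dvd_conductorNorm_iff_not_hasGoodReductionAtPrime ℓ).mp (hN'n ▸ hℓN')
  by_cases hr : RamifiedInQuadratic d ℓ
  · rcases hr with hdvd | ⟨h2ℓ, -⟩
    · exact hd ℓ hℓ hdvd
    · subst h2ℓ
      simpa using h2
  · have hbadW : ¬ W.HasGoodReductionAtPrime ℓ := fun hg ↦ hbad
      (Summit.BirchSwinnertonDyer.BirchSwinnertonDyer.Theorems.SignedBaseChangeK2RFrames.hasGoodReductionAtPrime_of_smul_eq_quadraticTwist_of_not_ramifiedInQuadratic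
        W W' hC hℓ hg hr)
    have hNn : N = W.conductorNorm ℤ := by exact_mod_cast hN
    exact hHeeg ℓ hℓ (hNn ▸ (W.dvd_conductorNorm_iff_not_hasGoodReductionAtPrime ℓ).mpr hbadW)

/-! ## §3 The load-bearing stub split: AC = ACμ ∧ ACdiv; ACμ by name modulo BCS 2025 Prop. 4.2.2 (guarded) -/

/-- **ACμ ⇐ the guarded Burungale–Castella–Skinner 2025 Prop. 4.2.2 (Hsieh's `μ = 0` in Greenberg-frame form),
BY NAME.** Under the hypotheses of `stub_anticyclotomicAnchor` (good `p ≥ 5`, `Surj W p`, `K` imaginary quadratic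
with `p = v v̄` split, `(N, D_K) = 1`, every `ℓ ∣ N` split in `K`, `D_K` odd `≠ −3`, the cyclotomic/anticyclotomic
tower, a genuine Katz frame and a Greenberg frame `G` of the newform `f` of `W`): `G⁻ ≠ 0`. (irr_K) comes from
`Surj` (`Rank1Residual.irrK_of_surj`); the named fact gives `HasUnitContent (minus G)`, in particular `G⁻ ≠ 0`.
Conditional on that ONE refereed fact (Hsieh 2014 Thm. B + the CGS/BCS comparison), nothing else. -/
theorem acMu_of_prop422
    (h422 : Literature.NumberTheory.EllipticCurves.BurungaleCastellaSkinner2025.prop422_greenbergAnyRoot_hasUnitContent_minus) :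
    Literature.NumberTheory.EllipticCurves.ModularForms.nonempty_modularParametrizationData → ∀ (W : WeierstrassCurve ℚ) [W.IsElliptic] [W.IsGloballyMinimal] (p : ℕ) [Fact p.Prime], 5 ≤ p → W.HasGoodReductionAtPrime p → Literature.NumberTheory.EllipticCurves.Rank1Residual.Surj W p → ∀ (K : Type) [Field K] [NumberField K] (ι : PadicAlgCl p ≃+* ℂ) (v vbar : IsDedekindDomain.HeightOneSpectrum (NumberField.RingOfIntegers K)) (κ₁ κ₂ : ZpExtension K p) (γ₁ γ₂ : Field.absoluteGaloisGroup K) [Fact (ZpExtension.IsTopGeneratorPair κ₁ κ₂ γ₁ γ₂)] [NeZero (NumberField.discr K).natAbs] (N : ℕ) [NeZero N] (f : CuspForm (CongruenceSubgroup.Gamma0 N) 2), IsNewformOf W f → (N : ℤ) = W.conductorNorm ℤ → IsImaginaryQuadratic K → ((Ideal.span {(p : ℤ)}).primesOver (NumberField.RingOfIntegers K)).ncard = 2 → ((p : ℕ) : NumberField.RingOfIntegers K) ∈ v.asIdeal → ((p : ℕ) : NumberField.RingOfIntegers K) ∈ vbar.asIdeal → vbar ≠ v → (∀ (w : NumberField.InfinitePlace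 K) (k : NumberField.RingOfIntegers K), k ∈ v.asIdeal ↔ ‖ι.symm (w.embedding (k : K))‖ < 1) → IsCoprime (N : ℤ) (NumberField.discr K) → (∀ ℓ : ℕ, ℓ.Prime → ℓ ∣ N → ((Ideal.span {(ℓ : ℤ)}).primesOver (NumberField.RingOfIntegers K)).ncard = 2) → Odd (NumberField.discr K) → NumberField.discr K ≠ -3 → κ₁.IsCyclotomic → κ₂.IsAnticyclotomic → ∀ (Ω δ : ℂ) (Ωp : (unrIntegers p)ˣ) (LK G : PowerSeries (PowerSeries (PadicComplexInt p))), Ω ≠ 0 → (δ ^ 2 = (NumberField.discr K : ℂ) ∨ δ ^ 2 = -(NumberField.discr K : ℂ)) → IsKatzMeasure₂ ι v vbar ∅ κ₁ κ₂ γ₁⁻¹ γ₂⁻¹ 1 Ω δ ((Ωp : unrIntegers p) : PadicComplex p) LK → IsGreenbergLFunctionAnyRoot₂ ι v vbar κ₁ κ₂ γ₁⁻¹ γ₂⁻¹ f (NumberField.discr K).natAbs (NumberField.classNumber K) LK G → ∀ J : ℤ_[p] →+* PadicComplexInt p, (∀ x : ℤ_[p], ((J x : PadicComplexInt p) : PadicComplex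 p) = ((x : ℚ_[p]) : PadicComplex p)) → UnrSeries₂.minus G ≠ 0 := by
  intro hmodP W _ _ p _ hp hgood hs K _ _ ι v vbar κ₁ κ₂ γ₁ γ₂ _ _ N _ f hf hN hK hsplit hv hvbar hvv hι
    hcop hHeeg hodd hne3 hκ₁ hκ₂ Ω δ Ωp LK G hΩ hδ hLK hG J hJ
  have hp2 : 2 < p := by omega
  have hirr : (W.baseChange K).HasIrreducibleModPGaloisRep p :=
    Summit.BirchSwinnertonDyer.Rank1Residual.irrK_of_surj W p hs K hK.1
  have huc := h422 ι W K v vbar κ₁ κ₂ γ₁ γ₂ hf hN hp2 hgood hK hHeeg hsplit hodd hne3 hcop hirr hv hvbar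
    hvv hι hκ₁ hκ₂ Ω δ Ωp LK G hΩ hδ hLK hG
  obtain ⟨n, hn⟩ := huc
  intro h0
  rw [h0, map_zero] at hn
  exact not_isUnit_zero hn

/-- The trivial reassembly **AC ⇐ ACμ ∧ ACdiv** (texts verbatim). -/
theorem ac_of_acMu_of_acDiv
    (hμ : Literature.NumberTheory.EllipticCurves.ModularForms.nonempty_modularParametrizationData → ∀ (W : WeierstrassCurve ℚ) [W.IsElliptic] [W.IsGloballyMinimal] (p : ℕ) [Fact p.Prime], 5 ≤ p → W.HasGoodReductionAtPrime p → Literature.NumberTheory.EllipticCurves.Rank1Residual.Surj W p → ∀ (K : Type) [Field K] [NumberField K] (ι : PadicAlgCl p ≃+* ℂ) (v vbar : IsDedekindDomain.HeightOneSpectrum (NumberField.RingOfIntegers K)) (κ₁ κ₂ : ZpExtension K p) (γ₁ γ₂ : Field.absoluteGaloisGroup K) [Fact (ZpExtension.IsTopGeneratorPair κ₁ κ₂ γ₁ γ₂)] [NeZero (NumberField.discr K).natAbs] (N : ℕ) [NeZero N] (f : CuspForm (CongruenceSubgroup.Gamma0 N) 2), IsNewformOf W f → (N : ℤ) = W.conductorNorm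 ℤ → IsImaginaryQuadratic K → ((Ideal.span {(p : ℤ)}).primesOver (NumberField.RingOfIntegers K)).ncard = 2 → ((p : ℕ) : NumberField.RingOfIntegers K) ∈ v.asIdeal → ((p : ℕ) : NumberField.RingOfIntegers K) ∈ vbar.asIdeal → vbar ≠ v → (∀ (w : NumberField.InfinitePlace K) (k : NumberField.RingOfIntegers K), k ∈ v.asIdeal ↔ ‖ι.symm (w.embedding (k : K))‖ < 1) → IsCoprime (N : ℤ) (NumberField.discr K) → (∀ ℓ : ℕ, ℓ.Prime → ℓ ∣ N → ((Ideal.span {(ℓ : ℤ)}).primesOver (NumberField.RingOfIntegers K)).ncard = 2) → Odd (NumberField.discr K) → NumberField.discr K ≠ -3 → κ₁.IsCyclotomic → κ₂.IsAnticyclotomic → ∀ (Ω δ : ℂ) (Ωp : (unrIntegers p)ˣ) (LK G : PowerSeries (PowerSeries (PadicComplexInt p))), Ω ≠ 0 → (δ ^ 2 = (NumberField.discr K : ℂ) ∨ δ ^ 2 = -(NumberField.discr K : ℂ)) → IsKatzMeasure₂ ι v vbar ∅ κ₁ κ₂ γ₁⁻¹ γ₂⁻¹ 1 Ω δ ((Ωp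 : unrIntegers p) : PadicComplex p) LK → IsGreenbergLFunctionAnyRoot₂ ι v vbar κ₁ κ₂ γ₁⁻¹ γ₂⁻¹ f (NumberField.discr K).natAbs (NumberField.classNumber K) LK G → ∀ J : ℤ_[p] →+* PadicComplexInt p, (∀ x : ℤ_[p], ((J x : PadicComplexInt p) : PadicComplex p) = ((x : ℚ_[p]) : PadicComplex p)) → UnrSeries₂.minus G ≠ 0)
    (hdiv : Literature.NumberTheory.EllipticCurves.ModularForms.nonempty_modularParametrizationData → ∀ (W : WeierstrassCurve ℚ) [W.IsElliptic] [W.IsGloballyMinimal] (p : ℕ) [Fact p.Prime], 5 ≤ p → W.HasGoodReductionAtPrime p → Literature.NumberTheory.EllipticCurves.Rank1Residual.Surj W p → ∀ (K : Type) [Field K] [NumberField K] (ι : PadicAlgCl p ≃+* ℂ) (v vbar : IsDedekindDomain.HeightOneSpectrum (NumberField.RingOfIntegers K)) (κ₁ κ₂ : ZpExtension K p) (γ₁ γ₂ : Field.absoluteGaloisGroup K) [Fact (ZpExtension.IsTopGeneratorPair κ₁ κ₂ γ₁ γ₂)] [NeZero (NumberField.discr K).natAbs] (N : ℕ) [NeZero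 N] (f : CuspForm (CongruenceSubgroup.Gamma0 N) 2), IsNewformOf W f → (N : ℤ) = W.conductorNorm ℤ → IsImaginaryQuadratic K → ((Ideal.span {(p : ℤ)}).primesOver (NumberField.RingOfIntegers K)).ncard = 2 → ((p : ℕ) : NumberField.RingOfIntegers K) ∈ v.asIdeal → ((p : ℕ) : NumberField.RingOfIntegers K) ∈ vbar.asIdeal → vbar ≠ v → (∀ (w : NumberField.InfinitePlace K) (k : NumberField.RingOfIntegers K), k ∈ v.asIdeal ↔ ‖ι.symm (w.embedding (k : K))‖ < 1) → IsCoprime (N : ℤ) (NumberField.discr K) → (∀ ℓ : ℕ, ℓ.Prime → ℓ ∣ N → ((Ideal.span {(ℓ : ℤ)}).primesOver (NumberField.RingOfIntegers K)).ncard = 2) → Odd (NumberField.discr K) → NumberField.discr K ≠ -3 → κ₁.IsCyclotomic → κ₂.IsAnticyclotomic → ∀ (Ω δ : ℂ) (Ωp : (unrIntegers p)ˣ) (LK G : PowerSeries (PowerSeries (PadicComplexInt p))), Ω ≠ 0 → (δ ^ 2 = (NumberField.discr K : ℂ) ∨ δ ^ 2 = -(NumberField.discr K : ℂ)) → IsKatzMeasure₂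 ι v vbar ∅ κ₁ κ₂ γ₁⁻¹ γ₂⁻¹ 1 Ω δ ((Ωp : unrIntegers p) : PadicComplex p) LK → IsGreenbergLFunctionAnyRoot₂ ι v vbar κ₁ κ₂ γ₁⁻¹ γ₂⁻¹ f (NumberField.discr K).natAbs (NumberField.classNumber K) LK G → ∀ J : ℤ_[p] →+* PadicComplexInt p, (∀ x : ℤ_[p], ((J x : PadicComplexInt p) : PadicComplex p) = ((x : ℚ_[p]) : PadicComplex p)) → ((WeierstrassCurve.XGr₂.charIdeal (W.baseChange K) p κ₁ κ₂ vbar γ₁ γ₂).map (IwasawaAlgebra₂.toUnr₂ p J)).map (PowerSeries.constantCoeff (R := PowerSeries (PadicComplexInt p))) ≤ Ideal.span {UnrSeries₂.minus G}) :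
    Literature.NumberTheory.EllipticCurves.ModularForms.nonempty_modularParametrizationData → ∀ (W : WeierstrassCurve ℚ) [W.IsElliptic] [W.IsGloballyMinimal] (p : ℕ) [Fact p.Prime], 5 ≤ p → W.HasGoodReductionAtPrime p → Literature.NumberTheory.EllipticCurves.Rank1Residual.Surj W p → ∀ (K : Type) [Field K] [NumberField K] (ι : PadicAlgCl p ≃+* ℂ) (v vbar : IsDedekindDomain.HeightOneSpectrum (NumberField.RingOfIntegers K)) (κ₁ κ₂ : ZpExtension K p) (γ₁ γ₂ : Field.absoluteGaloisGroup K) [Fact (ZpExtension.IsTopGeneratorPair κ₁ κ₂ γ₁ γ₂)] [NeZero (NumberField.discr K).natAbs] (N : ℕ) [NeZero N] (f : CuspForm (CongruenceSubgroup.Gamma0 N) 2), IsNewformOf W f → (N : ℤ) = W.conductorNorm ℤ → IsImaginaryQuadratic K → ((Ideal.span {(p : ℤ)}).primesOver (NumberField.RingOfIntegers K)).ncard = 2 → ((p : ℕ) : NumberField.RingOfIntegers K) ∈ v.asIdeal → ((p : ℕ) : NumberField.RingOfIntegers K) ∈ vbar.asIdeal → vbar ≠ v → (∀ (w : NumberField.InfinitePlace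 K) (k : NumberField.RingOfIntegers K), k ∈ v.asIdeal ↔ ‖ι.symm (w.embedding (k : K))‖ < 1) → IsCoprime (N : ℤ) (NumberField.discr K) → (∀ ℓ : ℕ, ℓ.Prime → ℓ ∣ N → ((Ideal.span {(ℓ : ℤ)}).primesOver (NumberField.RingOfIntegers K)).ncard = 2) → Odd (NumberField.discr K) → NumberField.discr K ≠ -3 → κ₁.IsCyclotomic → κ₂.IsAnticyclotomic → ∀ (Ω δ : ℂ) (Ωp : (unrIntegers p)ˣ) (LK G : PowerSeries (PowerSeries (PadicComplexInt p))), Ω ≠ 0 → (δ ^ 2 = (NumberField.discr K : ℂ) ∨ δ ^ 2 = -(NumberField.discr K : ℂ)) → IsKatzMeasure₂ ι v vbar ∅ κ₁ κ₂ γ₁⁻¹ γ₂⁻¹ 1 Ω δ ((Ωp : unrIntegers p) : PadicComplex p) LK → IsGreenbergLFunctionAnyRoot₂ ι v vbar κ₁ κ₂ γ₁⁻¹ γ₂⁻¹ f (NumberField.discr K).natAbs (NumberField.classNumber K) LK G → ∀ J : ℤ_[p] →+* PadicComplexInt p, (∀ x : ℤ_[p], ((J x : PadicComplexInt p) : PadicComplex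 p) = ((x : ℚ_[p]) : PadicComplex p)) → UnrSeries₂.minus G ≠ 0 ∧ ((WeierstrassCurve.XGr₂.charIdeal (W.baseChange K) p κ₁ κ₂ vbar γ₁ γ₂).map (IwasawaAlgebra₂.toUnr₂ p J)).map (PowerSeries.constantCoeff (R := PowerSeries (PadicComplexInt p))) ≤ Ideal.span {UnrSeries₂.minus G} :=
  fun hmodP W _ _ p _ hp hgood hs K _ _ ι v vbar κ₁ κ₂ γ₁ γ₂ _ _ N _ f hf hN hK hsplit hv hvbar hvv hι hcop
      hHeeg hodd hne3 hκ₁ hκ₂ Ω δ Ωp LK G hΩ hδ hLK hG J hJ ↦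
    ⟨hμ hmodP W p hp hgood hs K ι v vbar κ₁ κ₂ γ₁ γ₂ N f hf hN hK hsplit hv hvbar hvv hι hcop hHeeg hodd hne3
        hκ₁ hκ₂ Ω δ Ωp LK G hΩ hδ hLK hG J hJ,
      hdiv hmodP W p hp hgood hs K ι v vbar κ₁ κ₂ γ₁ γ₂ N f hf hN hK hsplit hv hvbar hvv hι hcop hHeeg hodd hne3
        hκ₁ hκ₂ Ω δ Ωp LK G hΩ hδ hLK hG J hJ⟩

/-! ## §4 The composition of line `acanchor` with its stubs as hypotheses: K1′ by name -/

/-- **K1′ ⇐ ES ∧ AC** (the registered stubs of `Lines/acanchor.lean`, texts VERBATIM as hypotheses): the landed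
`∃`-half `stub_frameDataBCSsplit` (p525981) supplies the package; per factor (ES) + (AC) + principality +
rigidity give the integral inclusion `ch ⊆ (G)`; good reduction, surjectivity, `(N′, D_K) = 1` and Heegner for the
twist come from §2 and K2R's lemmas; the product clause holds with `s = 1`. (Strategist's composition, with the
two `sorry`s replaced by the hypotheses.) -/
theorem twistPairGreenbergProductDivisibilitySplit_of_eulerSystem_of_anchor
    (hES : Literature.NumberTheory.EllipticCurves.ModularForms.nonempty_modularParametrizationData → ∀ (W : WeierstrassCurve ℚ) [W.IsElliptic] [W.IsGloballyMinimal] (p : ℕ) [Fact p.Prime], 5 ≤ p → W.HasGoodReductionAtPrime p → Literature.NumberTheory.EllipticCurves.Rank1Residual.Surj W p → ∀ (K : Type) [Field K] [NumberField K] (ι : PadicAlgCl p ≃+* ℂ) (v vbar : IsDedekindDomain.HeightOneSpectrum (NumberField.RingOfIntegers K)) (κ₁ κ₂ : ZpExtension K p) (γ₁ γ₂ : Field.absoluteGaloisGroup K) [Fact (ZpExtension.IsTopGeneratorPair κ₁ κ₂ γ₁ γ₂)] [NeZero (NumberField.discr K).natAbs] (N : ℕ) [NeZero N] (f : CuspForm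 (CongruenceSubgroup.Gamma0 N) 2), IsNewformOf W f → (N : ℤ) = W.conductorNorm ℤ → IsImaginaryQuadratic K → ((Ideal.span {(p : ℤ)}).primesOver (NumberField.RingOfIntegers K)).ncard = 2 → ((p : ℕ) : NumberField.RingOfIntegers K) ∈ v.asIdeal → ((p : ℕ) : NumberField.RingOfIntegers K) ∈ vbar.asIdeal → vbar ≠ v → (∀ (w : NumberField.InfinitePlace K) (k : NumberField.RingOfIntegers K), k ∈ v.asIdeal ↔ ‖ι.symm (w.embedding (k : K))‖ < 1) → IsCoprime (N : ℤ) (NumberField.discr K) → (∀ ℓ : ℕ, ℓ.Prime → ℓ ∣ N → ((Ideal.span {(ℓ : ℤ)}).primesOver (NumberField.RingOfIntegers K)).ncard = 2) → Odd (NumberField.discr K) → NumberField.discr K ≠ -3 → κ₁.IsCyclotomic → κ₂.IsAnticyclotomic → ∀ (Ω δ : ℂ) (Ωp : (unrIntegers p)ˣ) (LK G : PowerSeries (PowerSeries (PadicComplexInt p))), Ω ≠ 0 → (δ ^ 2 = (NumberField.discr K : ℂ) ∨ δ ^ 2 = -(NumberField.discr K : ℂ)) → IsKatzMeasure₂ ι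 v vbar ∅ κ₁ κ₂ γ₁⁻¹ γ₂⁻¹ 1 Ω δ ((Ωp : unrIntegers p) : PadicComplex p) LK → IsGreenbergLFunctionAnyRoot₂ ι v vbar κ₁ κ₂ γ₁⁻¹ γ₂⁻¹ f (NumberField.discr K).natAbs (NumberField.classNumber K) LK G → ∀ J : ℤ_[p] →+* PadicComplexInt p, (∀ x : ℤ_[p], ((J x : PadicComplexInt p) : PadicComplex p) = ((x : ℚ_[p]) : PadicComplex p)) → Ideal.span {G} ≤ (WeierstrassCurve.XGr₂.charIdeal (W.baseChange K) p κ₁ κ₂ vbar γ₁ γ₂).map (IwasawaAlgebra₂.toUnr₂ p J))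
    (hAC : Literature.NumberTheory.EllipticCurves.ModularForms.nonempty_modularParametrizationData → ∀ (W : WeierstrassCurve ℚ) [W.IsElliptic] [W.IsGloballyMinimal] (p : ℕ) [Fact p.Prime], 5 ≤ p → W.HasGoodReductionAtPrime p → Literature.NumberTheory.EllipticCurves.Rank1Residual.Surj W p → ∀ (K : Type) [Field K] [NumberField K] (ι : PadicAlgCl p ≃+* ℂ) (v vbar : IsDedekindDomain.HeightOneSpectrum (NumberField.RingOfIntegers K)) (κ₁ κ₂ : ZpExtension K p) (γ₁ γ₂ : Field.absoluteGaloisGroup K) [Fact (ZpExtension.IsTopGeneratorPair κ₁ κ₂ γ₁ γ₂)] [NeZero (NumberField.discr K).natAbs] (N : ℕ) [NeZero N] (f : CuspForm (CongruenceSubgroup.Gamma0 N) 2), IsNewformOf W f → (N : ℤ) = W.conductorNorm ℤ → IsImaginaryQuadratic K → ((Ideal.span {(p : ℤ)}).primesOver (NumberField.RingOfIntegers K)).ncard = 2 → ((p : ℕ) : NumberField.RingOfIntegers K) ∈ v.asIdeal → ((p : ℕ) : NumberField.RingOfIntegers K) ∈ vbar.asIdeal → vbar ≠ v → (∀ (w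 : NumberField.InfinitePlace K) (k : NumberField.RingOfIntegers K), k ∈ v.asIdeal ↔ ‖ι.symm (w.embedding (k : K))‖ < 1) → IsCoprime (N : ℤ) (NumberField.discr K) → (∀ ℓ : ℕ, ℓ.Prime → ℓ ∣ N → ((Ideal.span {(ℓ : ℤ)}).primesOver (NumberField.RingOfIntegers K)).ncard = 2) → Odd (NumberField.discr K) → NumberField.discr K ≠ -3 → κ₁.IsCyclotomic → κ₂.IsAnticyclotomic → ∀ (Ω δ : ℂ) (Ωp : (unrIntegers p)ˣ) (LK G : PowerSeries (PowerSeries (PadicComplexInt p))), Ω ≠ 0 → (δ ^ 2 = (NumberField.discr K : ℂ) ∨ δ ^ 2 = -(NumberField.discr K : ℂ)) → IsKatzMeasure₂ ι v vbar ∅ κ₁ κ₂ γ₁⁻¹ γ₂⁻¹ 1 Ω δ ((Ωp : unrIntegers p) : PadicComplex p) LK → IsGreenbergLFunctionAnyRoot₂ ι v vbar κ₁ κ₂ γ₁⁻¹ γ₂⁻¹ f (NumberField.discr K).natAbs (NumberField.classNumber K) LK G → ∀ J : ℤ_[p] →+* PadicComplexInt p, (∀ x : ℤ_[p], ((J x :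 PadicComplexInt p) : PadicComplex p) = ((x : ℚ_[p]) : PadicComplex p)) → UnrSeries₂.minus G ≠ 0 ∧ ((WeierstrassCurve.XGr₂.charIdeal (W.baseChange K) p κ₁ κ₂ vbar γ₁ γ₂).map (IwasawaAlgebra₂.toUnr₂ p J)).map (PowerSeries.constantCoeff (R := PowerSeries (PadicComplexInt p))) ≤ Ideal.span {UnrSeries₂.minus G}) :
    TwistPairGreenbergProductDivisibilitySplit := by
  intro hmodP W _ _ p _ hp hX hs
  obtain ⟨K, iF, iNF, ι, v, vbar, κ₁, κ₂, γ₁, γ₂, iPair, iD, N, iN, f, d, W', iE', iM', C, N', iN', f',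
      h0, h1, h2, h3, h4, h5, h6, h7, h8, h9, h10, h11, h12, h13, h14, h15, h16, h17,
      e1, e2, e3, e4, e5, e6, e7⟩ :=
    Summit.BirchSwinnertonDyer.BirchSwinnertonDyer.Theorems.SignedBaseChangeK1FrameDataBCSSplit.stub_frameDataBCSsplit
      hmodP W p hp hX hs
  -- per-factor hypotheses for `W` and for the twist `W'`
  have hgood : W.HasGoodReductionAtPrime p := hX.1.1
  have hgood' : W'.HasGoodReductionAtPrime p :=
    Summit.BirchSwinnertonDyer.BirchSwinnertonDyer.Theorems.SignedBaseChangeK2RFrames.hasGoodReductionAtPrime_of_smul_eq_quadraticTwist_of_not_ramifiedInQuadratic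
      W W' h7 Fact.out hgood (fun hr ↦ (h6 p Fact.out hr).1 rfl)
  have hs' : Literature.NumberTheory.EllipticCurves.Rank1Residual.Surj W' p :=
    surj_of_smul_eq_quadraticTwist W W' p h5 h7 hs
  have h14' : IsCoprime (N' : ℤ) (NumberField.discr K) :=
    Summit.BirchSwinnertonDyer.BirchSwinnertonDyer.Theorems.SignedBaseChangeK2RFrames.isCoprime_conductorNorm_twist_discr
      W W' h7 h1 h3 (fun q hq hr ↦ ⟨(h6 q hq hr).2.1, (h6 q hq hr).2.2⟩) h14
  have e1' := heegner_twist W W' h7 h1 h3 (K := K) e1 e5 e2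
  refine ⟨K, iF, iNF, ι, v, vbar, κ₁, κ₂, γ₁, γ₂, iPair, iD, N, iN, f, d, W', iE', iM', C, N', iN', f',
    h0, h1, h2, h3, h4, h5, h6, h7, h8, h9, h10, h11, h12, h13, h14, e1, e5, e2, h15, h16, h17, ?_⟩
  intro Ω δ Ωp LK G G' hΩ hδ hLK hG hG' J hJ
  have hACW := hAC hmodP W p hp hgood hs K ι v vbar κ₁ κ₂ γ₁ γ₂ N f h0 h1 h8 h9 h10 h11 h12 h13 h14 e1
    e3.1 e3.2 h16 h17 Ω δ Ωp LK G hΩ hδ hLK hG J hJ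
  have hACW' := hAC hmodP W' p hp hgood' hs' K ι v vbar κ₁ κ₂ γ₁ γ₂ N' f' h2 h3 h8 h9 h10 h11 h12 h13 h14'
    e1' e3.1 e3.2 h16 h17 Ω δ Ωp LK G' hΩ hδ hLK hG' J hJ
  have hA : (WeierstrassCurve.XGr₂.charIdeal (W.baseChange K) p κ₁ κ₂ vbar γ₁ γ₂).map
      (IwasawaAlgebra₂.toUnr₂ p J) ≤ Ideal.span {G} :=
    map_le_span_of_anchor (charIdealIsPrincipal₂ p _) J
      (hES hmodP W p hp hgood hs K ι v vbar κ₁ κ₂ γ₁ γ₂ N f h0 h1 h8 h9 h10 h11 h12 h13 h14 e1 e3.1 e3.2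
        h16 h17 Ω δ Ωp LK G hΩ hδ hLK hG J hJ) hACW.1 hACW.2
  have hB : (WeierstrassCurve.XGr₂.charIdeal (W'.baseChange K) p κ₁ κ₂ vbar γ₁ γ₂).map
      (IwasawaAlgebra₂.toUnr₂ p J) ≤ Ideal.span {G'} :=
    map_le_span_of_anchor (charIdealIsPrincipal₂ p _) J
      (hES hmodP W' p hp hgood' hs' K ι v vbar κ₁ κ₂ γ₁ γ₂ N' f' h2 h3 h8 h9 h10 h11 h12 h13 h14' e1'
        e3.1 e3.2 h16 h17 Ω δ Ωp LK G' hΩ hδ hLK hG' J hJ) hACW'.1 hACW'.2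
  exact ⟨1, one_ne_zero, span_C_one_mul_mul_le hA hB⟩

/-- **K1′ ⇐ ES ∧ ACμ ∧ ACdiv** (the lead's three-stub shape). -/
theorem twistPairGreenbergProductDivisibilitySplit_of_eulerSystem_of_acMu_of_acDiv
    (hES : Literature.NumberTheory.EllipticCurves.ModularForms.nonempty_modularParametrizationData → ∀ (W : WeierstrassCurve ℚ) [W.IsElliptic] [W.IsGloballyMinimal] (p : ℕ) [Fact p.Prime], 5 ≤ p → W.HasGoodReductionAtPrime p → Literature.NumberTheory.EllipticCurves.Rank1Residual.Surj W p → ∀ (K : Type) [Field K] [NumberField K] (ι : PadicAlgCl p ≃+* ℂ) (v vbar : IsDedekindDomain.HeightOneSpectrum (NumberField.RingOfIntegers K)) (κ₁ κ₂ : ZpExtension K p) (γ₁ γ₂ : Field.absoluteGaloisGroup K) [Fact (ZpExtension.IsTopGeneratorPair κ₁ κ₂ γ₁ γ₂)] [NeZero (NumberField.discr K).natAbs] (N : ℕ) [NeZero N] (f : CuspForm (CongruenceSubgroup.Gamma0 N) 2), IsNewformOf W f → (N : ℤ) = W.conductorNorm ℤ → IsImaginaryQuadratic K → ((Ideal.span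 {(p : ℤ)}).primesOver (NumberField.RingOfIntegers K)).ncard = 2 → ((p : ℕ) : NumberField.RingOfIntegers K) ∈ v.asIdeal → ((p : ℕ) : NumberField.RingOfIntegers K) ∈ vbar.asIdeal → vbar ≠ v → (∀ (w : NumberField.InfinitePlace K) (k : NumberField.RingOfIntegers K), k ∈ v.asIdeal ↔ ‖ι.symm (w.embedding (k : K))‖ < 1) → IsCoprime (N : ℤ) (NumberField.discr K) → (∀ ℓ : ℕ, ℓ.Prime → ℓ ∣ N → ((Ideal.span {(ℓ : ℤ)}).primesOver (NumberField.RingOfIntegers K)).ncard = 2) → Odd (NumberField.discr K) → NumberField.discr K ≠ -3 → κ₁.IsCyclotomic → κ₂.IsAnticyclotomic → ∀ (Ω δ : ℂ) (Ωp : (unrIntegers p)ˣ) (LK G : PowerSeries (PowerSeries (PadicComplexInt p))), Ω ≠ 0 → (δ ^ 2 = (NumberField.discr K : ℂ) ∨ δ ^ 2 = -(NumberField.discr K : ℂ)) → IsKatzMeasure₂ ι v vbar ∅ κ₁ κ₂ γ₁⁻¹ γ₂⁻¹ 1 Ω δ ((Ωp : unrIntegers p) : PadicComplex p) LK → IsGreenbergLFunctionAnyRoot₂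 ι v vbar κ₁ κ₂ γ₁⁻¹ γ₂⁻¹ f (NumberField.discr K).natAbs (NumberField.classNumber K) LK G → ∀ J : ℤ_[p] →+* PadicComplexInt p, (∀ x : ℤ_[p], ((J x : PadicComplexInt p) : PadicComplex p) = ((x : ℚ_[p]) : PadicComplex p)) → Ideal.span {G} ≤ (WeierstrassCurve.XGr₂.charIdeal (W.baseChange K) p κ₁ κ₂ vbar γ₁ γ₂).map (IwasawaAlgebra₂.toUnr₂ p J))
    (hμ : Literature.NumberTheory.EllipticCurves.ModularForms.nonempty_modularParametrizationData → ∀ (W : WeierstrassCurve ℚ) [W.IsElliptic] [W.IsGloballyMinimal] (p : ℕ) [Fact p.Prime], 5 ≤ p → W.HasGoodReductionAtPrime p → Literature.NumberTheory.EllipticCurves.Rank1Residual.Surj W p → ∀ (K : Type) [Field K] [NumberField K] (ι : PadicAlgCl p ≃+* ℂ) (v vbar : IsDedekindDomain.HeightOneSpectrum (NumberField.RingOfIntegers K)) (κ₁ κ₂ : ZpExtension K p) (γ₁ γ₂ : Field.absoluteGaloisGroup K) [Fact (ZpExtension.IsTopGeneratorPair κ₁ κ₂ γ₁ γ₂)]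 [NeZero (NumberField.discr K).natAbs] (N : ℕ) [NeZero N] (f : CuspForm (CongruenceSubgroup.Gamma0 N) 2), IsNewformOf W f → (N : ℤ) = W.conductorNorm ℤ → IsImaginaryQuadratic K → ((Ideal.span {(p : ℤ)}).primesOver (NumberField.RingOfIntegers K)).ncard = 2 → ((p : ℕ) : NumberField.RingOfIntegers K) ∈ v.asIdeal → ((p : ℕ) : NumberField.RingOfIntegers K) ∈ vbar.asIdeal → vbar ≠ v → (∀ (w : NumberField.InfinitePlace K) (k : NumberField.RingOfIntegers K), k ∈ v.asIdeal ↔ ‖ι.symm (w.embedding (k : K))‖ < 1) → IsCoprime (N : ℤ) (NumberField.discr K) → (∀ ℓ : ℕ, ℓ.Prime → ℓ ∣ N → ((Ideal.span {(ℓ : ℤ)}).primesOver (NumberField.RingOfIntegers K)).ncard = 2) → Odd (NumberField.discr K) → NumberField.discr K ≠ -3 → κ₁.IsCyclotomic → κ₂.IsAnticyclotomic → ∀ (Ω δ : ℂ) (Ωp : (unrIntegers p)ˣ) (LK G : PowerSeries (PowerSeries (PadicComplexInt p))), Ω ≠ 0 → (δ ^ 2 = (NumberField.discr K : ℂ) ∨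 δ ^ 2 = -(NumberField.discr K : ℂ)) → IsKatzMeasure₂ ι v vbar ∅ κ₁ κ₂ γ₁⁻¹ γ₂⁻¹ 1 Ω δ ((Ωp : unrIntegers p) : PadicComplex p) LK → IsGreenbergLFunctionAnyRoot₂ ι v vbar κ₁ κ₂ γ₁⁻¹ γ₂⁻¹ f (NumberField.discr K).natAbs (NumberField.classNumber K) LK G → ∀ J : ℤ_[p] →+* PadicComplexInt p, (∀ x : ℤ_[p], ((J x : PadicComplexInt p) : PadicComplex p) = ((x : ℚ_[p]) : PadicComplex p)) → UnrSeries₂.minus G ≠ 0)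
    (hdiv : Literature.NumberTheory.EllipticCurves.ModularForms.nonempty_modularParametrizationData → ∀ (W : WeierstrassCurve ℚ) [W.IsElliptic] [W.IsGloballyMinimal] (p : ℕ) [Fact p.Prime], 5 ≤ p → W.HasGoodReductionAtPrime p → Literature.NumberTheory.EllipticCurves.Rank1Residual.Surj W p → ∀ (K : Type) [Field K] [NumberField K] (ι : PadicAlgCl p ≃+* ℂ) (v vbar : IsDedekindDomain.HeightOneSpectrum (NumberField.RingOfIntegers K)) (κ₁ κ₂ : ZpExtension K p) (γ₁ γ₂ : Field.absoluteGaloisGroup K) [Fact (ZpExtension.IsTopGeneratorPair κ₁ κ₂ γ₁ γ₂)] [NeZero (NumberField.discr K).natAbs] (N : ℕ) [NeZero N] (f : CuspForm (CongruenceSubgroup.Gamma0 N) 2), IsNewformOf W f → (N : ℤ) = W.conductorNorm ℤ → IsImaginaryQuadratic K → ((Ideal.span {(p : ℤ)}).primesOver (NumberField.RingOfIntegers K)).ncard = 2 → ((p : ℕ) : NumberField.RingOfIntegers K) ∈ v.asIdeal → ((p : ℕ) : NumberField.RingOfIntegers K) ∈ vbar.asIdeal → vbar ≠ v → (∀ (w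 : NumberField.InfinitePlace K) (k : NumberField.RingOfIntegers K), k ∈ v.asIdeal ↔ ‖ι.symm (w.embedding (k : K))‖ < 1) → IsCoprime (N : ℤ) (NumberField.discr K) → (∀ ℓ : ℕ, ℓ.Prime → ℓ ∣ N → ((Ideal.span {(ℓ : ℤ)}).primesOver (NumberField.RingOfIntegers K)).ncard = 2) → Odd (NumberField.discr K) → NumberField.discr K ≠ -3 → κ₁.IsCyclotomic → κ₂.IsAnticyclotomic → ∀ (Ω δ : ℂ) (Ωp : (unrIntegers p)ˣ) (LK G : PowerSeries (PowerSeries (PadicComplexInt p))), Ω ≠ 0 → (δ ^ 2 = (NumberField.discr K : ℂ) ∨ δ ^ 2 = -(NumberField.discr K : ℂ)) → IsKatzMeasure₂ ι v vbar ∅ κ₁ κ₂ γ₁⁻¹ γ₂⁻¹ 1 Ω δ ((Ωp : unrIntegers p) : PadicComplex p) LK → IsGreenbergLFunctionAnyRoot₂ ι v vbar κ₁ κ₂ γ₁⁻¹ γ₂⁻¹ f (NumberField.discr K).natAbs (NumberField.classNumber K) LK G → ∀ J : ℤ_[p] →+* PadicComplexInt p, (∀ x : ℤ_[p], ((J x :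 PadicComplexInt p) : PadicComplex p) = ((x : ℚ_[p]) : PadicComplex p)) → ((WeierstrassCurve.XGr₂.charIdeal (W.baseChange K) p κ₁ κ₂ vbar γ₁ γ₂).map (IwasawaAlgebra₂.toUnr₂ p J)).map (PowerSeries.constantCoeff (R := PowerSeries (PadicComplexInt p))) ≤ Ideal.span {UnrSeries₂.minus G}) :
    TwistPairGreenbergProductDivisibilitySplit :=
  twistPairGreenbergProductDivisibilitySplit_of_eulerSystem_of_anchor hES (ac_of_acMu_of_acDiv hμ hdiv)

/-- **K1′ ⇐ ES ∧ ACdiv, modulo the guarded BCS 2025 Prop. 4.2.2 BY NAME** — the honest residual of line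
`acanchor`: the integral two-variable Euler-system inclusion (ES), the anticyclotomic Eisenstein inclusion on
`T₁ = 0` (ACdiv, the card's kernel G2″), and one refereed named fact. CONDITIONAL (the named fact is unproved in
the tree); not a closure of the item. -/
theorem twistPairGreenbergProductDivisibilitySplit_of_eulerSystem_of_acDiv_of_prop422
    (h422 : Literature.NumberTheory.EllipticCurves.BurungaleCastellaSkinner2025.prop422_greenbergAnyRoot_hasUnitContent_minus)
    (hES : Literature.NumberTheory.EllipticCurves.ModularForms.nonempty_modularParametrizationData → ∀ (W : WeierstrassCurve ℚ) [W.IsElliptic] [W.IsGloballyMinimal] (p : ℕ) [Fact p.Prime], 5 ≤ p → W.HasGoodReductionAtPrime p → Literature.NumberTheory.EllipticCurves.Rank1Residual.Surj W p → ∀ (K : Type) [Field K] [NumberField K] (ι : PadicAlgCl p ≃+* ℂ) (v vbar : IsDedekindDomain.HeightOneSpectrum (NumberField.RingOfIntegers K)) (κ₁ κ₂ : ZpExtension K p) (γ₁ γ₂ : Field.absoluteGaloisGroup K) [Fact (ZpExtension.IsTopGeneratorPair κ₁ κ₂ γ₁ γ₂)] [NeZero (NumberField.discr K).natAbs] (N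 : ℕ) [NeZero N] (f : CuspForm (CongruenceSubgroup.Gamma0 N) 2), IsNewformOf W f → (N : ℤ) = W.conductorNorm ℤ → IsImaginaryQuadratic K → ((Ideal.span {(p : ℤ)}).primesOver (NumberField.RingOfIntegers K)).ncard = 2 → ((p : ℕ) : NumberField.RingOfIntegers K) ∈ v.asIdeal → ((p : ℕ) : NumberField.RingOfIntegers K) ∈ vbar.asIdeal → vbar ≠ v → (∀ (w : NumberField.InfinitePlace K) (k : NumberField.RingOfIntegers K), k ∈ v.asIdeal ↔ ‖ι.symm (w.embedding (k : K))‖ < 1) → IsCoprime (N : ℤ) (NumberField.discr K) → (∀ ℓ : ℕ, ℓ.Prime → ℓ ∣ N → ((Ideal.span {(ℓ : ℤ)}).primesOver (NumberField.RingOfIntegers K)).ncard = 2) → Odd (NumberField.discr K) → NumberField.discr K ≠ -3 → κ₁.IsCyclotomic → κ₂.IsAnticyclotomic → ∀ (Ω δ : ℂ) (Ωp : (unrIntegers p)ˣ) (LK G : PowerSeries (PowerSeries (PadicComplexInt p))), Ω ≠ 0 → (δ ^ 2 = (NumberField.discr K : ℂ) ∨ δ ^ 2 = -(NumberField.discr K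 : ℂ)) → IsKatzMeasure₂ ι v vbar ∅ κ₁ κ₂ γ₁⁻¹ γ₂⁻¹ 1 Ω δ ((Ωp : unrIntegers p) : PadicComplex p) LK → IsGreenbergLFunctionAnyRoot₂ ι v vbar κ₁ κ₂ γ₁⁻¹ γ₂⁻¹ f (NumberField.discr K).natAbs (NumberField.classNumber K) LK G → ∀ J : ℤ_[p] →+* PadicComplexInt p, (∀ x : ℤ_[p], ((J x : PadicComplexInt p) : PadicComplex p) = ((x : ℚ_[p]) : PadicComplex p)) → Ideal.span {G} ≤ (WeierstrassCurve.XGr₂.charIdeal (W.baseChange K) p κ₁ κ₂ vbar γ₁ γ₂).map (IwasawaAlgebra₂.toUnr₂ p J))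
    (hdiv : Literature.NumberTheory.EllipticCurves.ModularForms.nonempty_modularParametrizationData → ∀ (W : WeierstrassCurve ℚ) [W.IsElliptic] [W.IsGloballyMinimal] (p : ℕ) [Fact p.Prime], 5 ≤ p → W.HasGoodReductionAtPrime p → Literature.NumberTheory.EllipticCurves.Rank1Residual.Surj W p → ∀ (K : Type) [Field K] [NumberField K] (ι : PadicAlgCl p ≃+* ℂ) (v vbar : IsDedekindDomain.HeightOneSpectrum (NumberField.RingOfIntegers K)) (κ₁ κ₂ : ZpExtension K p) (γ₁ γ₂ : Field.absoluteGaloisGroup K) [Fact (ZpExtension.IsTopGeneratorPair κ₁ κ₂ γ₁ γ₂)] [NeZero (NumberField.discr K).natAbs] (N : ℕ) [NeZero N] (f : CuspForm (CongruenceSubgroup.Gamma0 N) 2), IsNewformOf W f → (N : ℤ) = W.conductorNorm ℤ → IsImaginaryQuadratic K → ((Ideal.span {(p : ℤ)}).primesOver (NumberField.RingOfIntegers K)).ncard = 2 → ((p : ℕ) : NumberField.RingOfIntegers K) ∈ v.asIdeal → ((p : ℕ) : NumberField.RingOfIntegers K) ∈ vbar.asIdeal → vbar ≠ v → (∀ (w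 : NumberField.InfinitePlace K) (k : NumberField.RingOfIntegers K), k ∈ v.asIdeal ↔ ‖ι.symm (w.embedding (k : K))‖ < 1) → IsCoprime (N : ℤ) (NumberField.discr K) → (∀ ℓ : ℕ, ℓ.Prime → ℓ ∣ N → ((Ideal.span {(ℓ : ℤ)}).primesOver (NumberField.RingOfIntegers K)).ncard = 2) → Odd (NumberField.discr K) → NumberField.discr K ≠ -3 → κ₁.IsCyclotomic → κ₂.IsAnticyclotomic → ∀ (Ω δ : ℂ) (Ωp : (unrIntegers p)ˣ) (LK G : PowerSeries (PowerSeries (PadicComplexInt p))), Ω ≠ 0 → (δ ^ 2 = (NumberField.discr K : ℂ) ∨ δ ^ 2 = -(NumberField.discr K : ℂ)) → IsKatzMeasure₂ ι v vbar ∅ κ₁ κ₂ γ₁⁻¹ γ₂⁻¹ 1 Ω δ ((Ωp : unrIntegers p) : PadicComplex p) LK → IsGreenbergLFunctionAnyRoot₂ ι v vbar κ₁ κ₂ γ₁⁻¹ γ₂⁻¹ f (NumberField.discr K).natAbs (NumberField.classNumber K) LK G → ∀ J : ℤ_[p] →+* PadicComplexInt p, (∀ x : ℤ_[p], ((J x :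 PadicComplexInt p) : PadicComplex p) = ((x : ℚ_[p]) : PadicComplex p)) → ((WeierstrassCurve.XGr₂.charIdeal (W.baseChange K) p κ₁ κ₂ vbar γ₁ γ₂).map (IwasawaAlgebra₂.toUnr₂ p J)).map (PowerSeries.constantCoeff (R := PowerSeries (PadicComplexInt p))) ≤ Ideal.span {UnrSeries₂.minus G}) :
    TwistPairGreenbergProductDivisibilitySplit :=
  twistPairGreenbergProductDivisibilitySplit_of_eulerSystem_of_acMu_of_acDiv hES (acMu_of_prop422 h422) hdiv

/-! ## §5 (appended, same seat): the same composition for the freeze-end re-statement K1″ = K1′ + «γ₁ canonical»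

After rev 14′ (tenure planner's certified package `HOME/bsd-wall-ss/rev14/`, applies 2026-08-28T09:11Z) the deciding crux is
K1″ `TwistPairGreenbergProductDivisibilityCanonical` (K1can.sig = K1′ + the clause `∃ ζ torsion, χ_cyc(γ₁)·ζ = cyclotomicGenerator p`
after `κ₂.IsAnticyclotomic ∧`). Line `acanchor` survives the re-base BY NAME: the composition below concludes K1can.sig VERBATIM from
the same stubs, with the `∃`-half FD″ (`SignedBaseChangeK1FrameDataCanonical.stub_frameDataBCSsplit_canonical`, p533831) in place of
FD and the canonical-generator conjunct threaded through (the stubs ES/AC never mention `γ₁`'s normalisation). -/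

/-- **K1″ (text VERBATIM = HOME/bsd-wall-ss/rev14/K1can.sig) ⇐ ES ∧ AC.** Same proof as
`twistPairGreenbergProductDivisibilitySplit_of_eulerSystem_of_anchor` with FD″ supplying the witnesses and `hcan` kept. -/
theorem twistPairGreenbergProductDivisibilityCanonical_of_eulerSystem_of_anchor
    (hES : Literature.NumberTheory.EllipticCurves.ModularForms.nonempty_modularParametrizationData → ∀ (W : WeierstrassCurve ℚ) [W.IsElliptic] [W.IsGloballyMinimal] (p : ℕ) [Fact p.Prime], 5 ≤ p → W.HasGoodReductionAtPrime p → Literature.NumberTheory.EllipticCurves.Rank1Residual.Surj W p → ∀ (K : Type) [Field K] [NumberField K] (ι : PadicAlgCl p ≃+* ℂ) (v vbar : IsDedekindDomain.HeightOneSpectrum (NumberField.RingOfIntegers K)) (κ₁ κ₂ : ZpExtension K p) (γ₁ γ₂ : Field.absoluteGaloisGroup K) [Fact (ZpExtension.IsTopGeneratorPair κ₁ κ₂ γ₁ γ₂)] [NeZero (NumberField.discr K).natAbs] (N : ℕ) [NeZero N] (f : CuspForm (CongruenceSubgroup.Gamma0 N) 2), IsNewformOf W f → (N : ℤ) = W.conductorNorm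 ℤ → IsImaginaryQuadratic K → ((Ideal.span {(p : ℤ)}).primesOver (NumberField.RingOfIntegers K)).ncard = 2 → ((p : ℕ) : NumberField.RingOfIntegers K) ∈ v.asIdeal → ((p : ℕ) : NumberField.RingOfIntegers K) ∈ vbar.asIdeal → vbar ≠ v → (∀ (w : NumberField.InfinitePlace K) (k : NumberField.RingOfIntegers K), k ∈ v.asIdeal ↔ ‖ι.symm (w.embedding (k : K))‖ < 1) → IsCoprime (N : ℤ) (NumberField.discr K) → (∀ ℓ : ℕ, ℓ.Prime → ℓ ∣ N → ((Ideal.span {(ℓ : ℤ)}).primesOver (NumberField.RingOfIntegers K)).ncard = 2) → Odd (NumberField.discr K) → NumberField.discr K ≠ -3 → κ₁.IsCyclotomic → κ₂.IsAnticyclotomic → ∀ (Ω δ : ℂ) (Ωp : (unrIntegers p)ˣ) (LK G : PowerSeries (PowerSeries (PadicComplexInt p))), Ω ≠ 0 → (δ ^ 2 = (NumberField.discr K : ℂ) ∨ δ ^ 2 = -(NumberField.discr K : ℂ)) → IsKatzMeasure₂ ι v vbar ∅ κ₁ κ₂ γ₁⁻¹ γ₂⁻¹ 1 Ω δ ((Ωp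 : unrIntegers p) : PadicComplex p) LK → IsGreenbergLFunctionAnyRoot₂ ι v vbar κ₁ κ₂ γ₁⁻¹ γ₂⁻¹ f (NumberField.discr K).natAbs (NumberField.classNumber K) LK G → ∀ J : ℤ_[p] →+* PadicComplexInt p, (∀ x : ℤ_[p], ((J x : PadicComplexInt p) : PadicComplex p) = ((x : ℚ_[p]) : PadicComplex p)) → Ideal.span {G} ≤ (WeierstrassCurve.XGr₂.charIdeal (W.baseChange K) p κ₁ κ₂ vbar γ₁ γ₂).map (IwasawaAlgebra₂.toUnr₂ p J))
    (hAC : Literature.NumberTheory.EllipticCurves.ModularForms.nonempty_modularParametrizationData → ∀ (W : WeierstrassCurve ℚ) [W.IsElliptic] [W.IsGloballyMinimal] (p : ℕ) [Fact p.Prime], 5 ≤ p → W.HasGoodReductionAtPrime p → Literature.NumberTheory.EllipticCurves.Rank1Residual.Surj W p → ∀ (K : Type) [Field K] [NumberField K] (ι : PadicAlgCl p ≃+* ℂ) (v vbar : IsDedekindDomain.HeightOneSpectrum (NumberField.RingOfIntegers K)) (κ₁ κ₂ : ZpExtension K p) (γ₁ γ₂ : Field.absoluteGaloisGroup K) [Fact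 (ZpExtension.IsTopGeneratorPair κ₁ κ₂ γ₁ γ₂)] [NeZero (NumberField.discr K).natAbs] (N : ℕ) [NeZero N] (f : CuspForm (CongruenceSubgroup.Gamma0 N) 2), IsNewformOf W f → (N : ℤ) = W.conductorNorm ℤ → IsImaginaryQuadratic K → ((Ideal.span {(p : ℤ)}).primesOver (NumberField.RingOfIntegers K)).ncard = 2 → ((p : ℕ) : NumberField.RingOfIntegers K) ∈ v.asIdeal → ((p : ℕ) : NumberField.RingOfIntegers K) ∈ vbar.asIdeal → vbar ≠ v → (∀ (w : NumberField.InfinitePlace K) (k : NumberField.RingOfIntegers K), k ∈ v.asIdeal ↔ ‖ι.symm (w.embedding (k : K))‖ < 1) → IsCoprime (N : ℤ) (NumberField.discr K) → (∀ ℓ : ℕ, ℓ.Prime → ℓ ∣ N → ((Ideal.span {(ℓ : ℤ)}).primesOver (NumberField.RingOfIntegers K)).ncard = 2) → Odd (NumberField.discr K) → NumberField.discr K ≠ -3 → κ₁.IsCyclotomic → κ₂.IsAnticyclotomic → ∀ (Ω δ : ℂ) (Ωp : (unrIntegers p)ˣ) (LK G : PowerSeries (PowerSeries (PadicComplexInt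 p))), Ω ≠ 0 → (δ ^ 2 = (NumberField.discr K : ℂ) ∨ δ ^ 2 = -(NumberField.discr K : ℂ)) → IsKatzMeasure₂ ι v vbar ∅ κ₁ κ₂ γ₁⁻¹ γ₂⁻¹ 1 Ω δ ((Ωp : unrIntegers p) : PadicComplex p) LK → IsGreenbergLFunctionAnyRoot₂ ι v vbar κ₁ κ₂ γ₁⁻¹ γ₂⁻¹ f (NumberField.discr K).natAbs (NumberField.classNumber K) LK G → ∀ J : ℤ_[p] →+* PadicComplexInt p, (∀ x : ℤ_[p], ((J x : PadicComplexInt p) : PadicComplex p) = ((x : ℚ_[p]) : PadicComplex p)) → UnrSeries₂.minus G ≠ 0 ∧ ((WeierstrassCurve.XGr₂.charIdeal (W.baseChange K) p κ₁ κ₂ vbar γ₁ γ₂).map (IwasawaAlgebra₂.toUnr₂ p J)).map (PowerSeries.constantCoeff (R := PowerSeries (PadicComplexInt p))) ≤ Ideal.span {UnrSeries₂.minus G}) :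
    Literature.NumberTheory.EllipticCurves.ModularForms.nonempty_modularParametrizationData → ∀ (W : WeierstrassCurve ℚ) [W.IsElliptic] [W.IsGloballyMinimal] (p : ℕ) [Fact p.Prime], 5 ≤ p → Literature.NumberTheory.EllipticCurves.Rank1Residual.ClassX7 W p → Literature.NumberTheory.EllipticCurves.Rank1Residual.Surj W p → ∃ (K : Type) (_ : Field K) (_ : NumberField K) (ι : PadicAlgCl p ≃+* ℂ) (v vbar : IsDedekindDomain.HeightOneSpectrum (NumberField.RingOfIntegers K)) (κ₁ κ₂ : Literature.NumberTheory.EllipticCurves.ZpExtension K p) (γ₁ γ₂ : Field.absoluteGaloisGroup K) (_ : Fact (Literature.NumberTheory.EllipticCurves.ZpExtension.IsTopGeneratorPair κ₁ κ₂ γ₁ γ₂)) (_ : NeZero (NumberField.discr K).natAbs) (N : ℕ) (_ : NeZero N) (f : CuspForm (CongruenceSubgroup.Gamma0 N) 2) (d : ℤ) (W' : WeierstrassCurve ℚ) (_ : W'.IsElliptic) (_ : W'.IsGloballyMinimal) (C : WeierstrassCurve.VariableChange ℚ) (N' : ℕ) (_ : NeZero N') (f' : CuspForm (CongruenceSubgroup.Gamma0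 N') 2), Literature.NumberTheory.EllipticCurves.ModularForms.IsNewformOf W f ∧ (N : ℤ) = W.conductorNorm ℤ ∧ Literature.NumberTheory.EllipticCurves.ModularForms.IsNewformOf W' f' ∧ (N' : ℤ) = W'.conductorNorm ℤ ∧ Squarefree d ∧ 1 < d ∧ (∀ q : ℕ, q.Prime → Literature.NumberTheory.EllipticCurves.BurungaleSkinnerTianWan2024.RamifiedInQuadratic d q → q ≠ p ∧ ¬ q ∣ N ∧ ¬ (q : ℤ) ∣ NumberField.discr K) ∧ C • W' = W.quadraticTwist (d : ℚ) ∧ Literature.NumberTheory.EllipticCurves.IsImaginaryQuadratic K ∧ ((Ideal.span {(p : ℤ)}).primesOver (NumberField.RingOfIntegers K)).ncard = 2 ∧ ((p : ℕ) : NumberField.RingOfIntegers K) ∈ v.asIdeal ∧ ((p : ℕ) : NumberField.RingOfIntegers K) ∈ vbar.asIdeal ∧ vbar ≠ v ∧ (∀ (w : NumberField.InfinitePlace K) (k : NumberField.RingOfIntegers K), k ∈ v.asIdeal ↔ ‖ι.symm (w.embedding (k : K))‖ < 1) ∧ IsCoprime (N : ℤ) (NumberField.discr K) ∧ (∀ ℓ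 : ℕ, ℓ.Prime → ℓ ∣ N → ((Ideal.span {(ℓ : ℤ)}).primesOver (NumberField.RingOfIntegers K)).ncard = 2) ∧ (∀ ℓ : ℕ, ℓ.Prime → (ℓ : ℤ) ∣ d → ((Ideal.span {(ℓ : ℤ)}).primesOver (NumberField.RingOfIntegers K)).ncard = 2) ∧ ((Ideal.span {(2 : ℤ)}).primesOver (NumberField.RingOfIntegers K)).ncard = 2 ∧ (∀ ρ : Literature.NumberTheory.GaloisRepresentations.ModPGaloisRep K (ZMod p) 2, (W.baseChange K).IsTorsionGaloisRep p ρ → Literature.NumberTheory.GaloisRepresentations.FramedRep.IsAbsolutelyIrreducible ρ) ∧ κ₁.IsCyclotomic ∧ κ₂.IsAnticyclotomic ∧ (∃ ζ : ℤ_[p]ˣ, IsOfFinOrder ζ ∧ ((Literature.NumberTheory.GaloisRepresentations.GaloisRep.cyclotomicCharacter K p γ₁ * ζ : ℤ_[p]ˣ) : ℤ_[p]) = (Literature.NumberTheory.EllipticCurves.cyclotomicGenerator p : ℤ_[p])) ∧ ∀ (Ω δ : ℂ) (Ωp : (Literature.NumberTheory.EllipticCurves.unrIntegers p)ˣ) (LK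 G G' : PowerSeries (PowerSeries (PadicComplexInt p))), Ω ≠ 0 → (δ ^ 2 = (NumberField.discr K : ℂ) ∨ δ ^ 2 = -(NumberField.discr K : ℂ)) → Literature.NumberTheory.EllipticCurves.IsKatzMeasure₂ ι v vbar ∅ κ₁ κ₂ γ₁⁻¹ γ₂⁻¹ 1 Ω δ ((Ωp : Literature.NumberTheory.EllipticCurves.unrIntegers p) : PadicComplex p) LK → Literature.NumberTheory.EllipticCurves.IsGreenbergLFunctionAnyRoot₂ ι v vbar κ₁ κ₂ γ₁⁻¹ γ₂⁻¹ f (NumberField.discr K).natAbs (NumberField.classNumber K) LK G → Literature.NumberTheory.EllipticCurves.IsGreenbergLFunctionAnyRoot₂ ι v vbar κ₁ κ₂ γ₁⁻¹ γ₂⁻¹ f' (NumberField.discr K).natAbs (NumberField.classNumber K) LK G' → ∀ J : ℤ_[p] →+* PadicComplexInt p, (∀ x : ℤ_[p], ((J x : PadicComplexInt p) : PadicComplex p) = ((x : ℚ_[p]) : PadicComplex p)) → ∃ s : PowerSeries (PadicComplexInt p), s ≠ 0 ∧ Ideal.span {PowerSeries.map (PowerSeries.C (R := PadicComplexInt p))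 s} * ((WeierstrassCurve.XGr₂.charIdeal (W.baseChange K) p κ₁ κ₂ vbar γ₁ γ₂).map (Literature.NumberTheory.EllipticCurves.IwasawaAlgebra₂.toUnr₂ p J) * (WeierstrassCurve.XGr₂.charIdeal (W'.baseChange K) p κ₁ κ₂ vbar γ₁ γ₂).map (Literature.NumberTheory.EllipticCurves.IwasawaAlgebra₂.toUnr₂ p J)) ≤ Ideal.span {G * G'} := by
  intro hmodP W _ _ p _ hp hX hs
  obtain ⟨K, iF, iNF, ι, v, vbar, κ₁, κ₂, γ₁, γ₂, iPair, iD, N, iN, f, d, W', iE', iM', C, N', iN', f',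
      h0, h1, h2, h3, h4, h5, h6, h7, h8, h9, h10, h11, h12, h13, h14, h15, h16, h17, hcan,
      e1, e2, e3, e4, e5, e6, e7⟩ :=
    Summit.BirchSwinnertonDyer.BirchSwinnertonDyer.Theorems.SignedBaseChangeK1FrameDataCanonical.stub_frameDataBCSsplit_canonical
      hmodP W p hp hX hs
  have hgood : W.HasGoodReductionAtPrime p := hX.1.1
  have hgood' : W'.HasGoodReductionAtPrime p :=
    Summit.BirchSwinnertonDyer.BirchSwinnertonDyer.Theorems.SignedBaseChangeK2RFrames.hasGoodReductionAtPrime_of_smul_eq_quadraticTwist_of_not_ramifiedInQuadratic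
      W W' h7 Fact.out hgood (fun hr ↦ (h6 p Fact.out hr).1 rfl)
  have hs' : Literature.NumberTheory.EllipticCurves.Rank1Residual.Surj W' p :=
    surj_of_smul_eq_quadraticTwist W W' p h5 h7 hs
  have h14' : IsCoprime (N' : ℤ) (NumberField.discr K) :=
    Summit.BirchSwinnertonDyer.BirchSwinnertonDyer.Theorems.SignedBaseChangeK2RFrames.isCoprime_conductorNorm_twist_discr
      W W' h7 h1 h3 (fun q hq hr ↦ ⟨(h6 q hq hr).2.1, (h6 q hq hr).2.2⟩) h14
  have e1' := heegner_twist W W' h7 h1 h3 (K := K) e1 e5 e2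
  refine ⟨K, iF, iNF, ι, v, vbar, κ₁, κ₂, γ₁, γ₂, iPair, iD, N, iN, f, d, W', iE', iM', C, N', iN', f',
    h0, h1, h2, h3, h4, h5, h6, h7, h8, h9, h10, h11, h12, h13, h14, e1, e5, e2, h15, h16, h17, hcan, ?_⟩
  intro Ω δ Ωp LK G G' hΩ hδ hLK hG hG' J hJ
  have hACW := hAC hmodP W p hp hgood hs K ι v vbar κ₁ κ₂ γ₁ γ₂ N f h0 h1 h8 h9 h10 h11 h12 h13 h14 e1
    e3.1 e3.2 h16 h17 Ω δ Ωp LK G hΩ hδ hLK hG J hJ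
  have hACW' := hAC hmodP W' p hp hgood' hs' K ι v vbar κ₁ κ₂ γ₁ γ₂ N' f' h2 h3 h8 h9 h10 h11 h12 h13 h14'
    e1' e3.1 e3.2 h16 h17 Ω δ Ωp LK G' hΩ hδ hLK hG' J hJ
  have hA : (WeierstrassCurve.XGr₂.charIdeal (W.baseChange K) p κ₁ κ₂ vbar γ₁ γ₂).map
      (IwasawaAlgebra₂.toUnr₂ p J) ≤ Ideal.span {G} :=
    map_le_span_of_anchor (charIdealIsPrincipal₂ p _) J
      (hES hmodP W p hp hgood hs K ι v vbar κ₁ κ₂ γ₁ γ₂ N f h0 h1 h8 h9 h10 h11 h12 h13 h14 e1 e3.1 e3.2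
        h16 h17 Ω δ Ωp LK G hΩ hδ hLK hG J hJ) hACW.1 hACW.2
  have hB : (WeierstrassCurve.XGr₂.charIdeal (W'.baseChange K) p κ₁ κ₂ vbar γ₁ γ₂).map
      (IwasawaAlgebra₂.toUnr₂ p J) ≤ Ideal.span {G'} :=
    map_le_span_of_anchor (charIdealIsPrincipal₂ p _) J
      (hES hmodP W' p hp hgood' hs' K ι v vbar κ₁ κ₂ γ₁ γ₂ N' f' h2 h3 h8 h9 h10 h11 h12 h13 h14' e1'
        e3.1 e3.2 h16 h17 Ω δ Ωp LK G' hΩ hδ hLK hG' J hJ) hACW'.1 hACW'.2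
  exact ⟨1, one_ne_zero, span_C_one_mul_mul_le hA hB⟩

/-- **K1″ ⇐ ES ∧ ACdiv modulo the guarded BCS 2025 Prop. 4.2.2 BY NAME** — the honest residual of line `acanchor` after the
freeze-end re-base, same as §4's for K1′. -/
theorem twistPairGreenbergProductDivisibilityCanonical_of_eulerSystem_of_acDiv_of_prop422
    (h422 : Literature.NumberTheory.EllipticCurves.BurungaleCastellaSkinner2025.prop422_greenbergAnyRoot_hasUnitContent_minus)
    (hES : Literature.NumberTheory.EllipticCurves.ModularForms.nonempty_modularParametrizationData → ∀ (W : WeierstrassCurve ℚ) [W.IsElliptic] [W.IsGloballyMinimal] (p : ℕ) [Fact p.Prime], 5 ≤ p → W.HasGoodReductionAtPrime p → Literature.NumberTheory.EllipticCurves.Rank1Residual.Surj W p → ∀ (K : Type) [Field K] [NumberField K] (ι : PadicAlgCl p ≃+* ℂ) (v vbar : IsDedekindDomain.HeightOneSpectrum (NumberField.RingOfIntegers K)) (κ₁ κ₂ : ZpExtension K p) (γ₁ γ₂ : Field.absoluteGaloisGroup K) [Fact (ZpExtension.IsTopGeneratorPair κ₁ κ₂ γ₁ γ₂)] [NeZero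 (NumberField.discr K).natAbs] (N : ℕ) [NeZero N] (f : CuspForm (CongruenceSubgroup.Gamma0 N) 2), IsNewformOf W f → (N : ℤ) = W.conductorNorm ℤ → IsImaginaryQuadratic K → ((Ideal.span {(p : ℤ)}).primesOver (NumberField.RingOfIntegers K)).ncard = 2 → ((p : ℕ) : NumberField.RingOfIntegers K) ∈ v.asIdeal → ((p : ℕ) : NumberField.RingOfIntegers K) ∈ vbar.asIdeal → vbar ≠ v → (∀ (w : NumberField.InfinitePlace K) (k : NumberField.RingOfIntegers K), k ∈ v.asIdeal ↔ ‖ι.symm (w.embedding (k : K))‖ < 1) → IsCoprime (N : ℤ) (NumberField.discr K) → (∀ ℓ : ℕ, ℓ.Prime → ℓ ∣ N → ((Ideal.span {(ℓ : ℤ)}).primesOver (NumberField.RingOfIntegers K)).ncard = 2) → Odd (NumberField.discr K) → NumberField.discr K ≠ -3 → κ₁.IsCyclotomic → κ₂.IsAnticyclotomic → ∀ (Ω δ : ℂ) (Ωp : (unrIntegers p)ˣ) (LK G : PowerSeries (PowerSeries (PadicComplexInt p))), Ω ≠ 0 → (δ ^ 2 = (NumberField.discr K : ℂ) ∨ δ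 ^ 2 = -(NumberField.discr K : ℂ)) → IsKatzMeasure₂ ι v vbar ∅ κ₁ κ₂ γ₁⁻¹ γ₂⁻¹ 1 Ω δ ((Ωp : unrIntegers p) : PadicComplex p) LK → IsGreenbergLFunctionAnyRoot₂ ι v vbar κ₁ κ₂ γ₁⁻¹ γ₂⁻¹ f (NumberField.discr K).natAbs (NumberField.classNumber K) LK G → ∀ J : ℤ_[p] →+* PadicComplexInt p, (∀ x : ℤ_[p], ((J x : PadicComplexInt p) : PadicComplex p) = ((x : ℚ_[p]) : PadicComplex p)) → Ideal.span {G} ≤ (WeierstrassCurve.XGr₂.charIdeal (W.baseChange K) p κ₁ κ₂ vbar γ₁ γ₂).map (IwasawaAlgebra₂.toUnr₂ p J))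
    (hdiv : Literature.NumberTheory.EllipticCurves.ModularForms.nonempty_modularParametrizationData → ∀ (W : WeierstrassCurve ℚ) [W.IsElliptic] [W.IsGloballyMinimal] (p : ℕ) [Fact p.Prime], 5 ≤ p → W.HasGoodReductionAtPrime p → Literature.NumberTheory.EllipticCurves.Rank1Residual.Surj W p → ∀ (K : Type) [Field K] [NumberField K] (ι : PadicAlgCl p ≃+* ℂ) (v vbar : IsDedekindDomain.HeightOneSpectrum (NumberField.RingOfIntegers K)) (κ₁ κ₂ : ZpExtension K p) (γ₁ γ₂ : Field.absoluteGaloisGroup K) [Fact (ZpExtension.IsTopGeneratorPair κ₁ κ₂ γ₁ γ₂)] [NeZero (NumberField.discr K).natAbs] (N : ℕ) [NeZero N] (f : CuspForm (CongruenceSubgroup.Gamma0 N) 2), IsNewformOf W f → (N : ℤ) = W.conductorNorm ℤ → IsImaginaryQuadratic K → ((Ideal.span {(p : ℤ)}).primesOver (NumberField.RingOfIntegers K)).ncard = 2 → ((p : ℕ) : NumberField.RingOfIntegers K) ∈ v.asIdeal → ((p : ℕ) : NumberField.RingOfIntegers K) ∈ vbar.asIdeal → vbar ≠ v → (∀ (w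 : NumberField.InfinitePlace K) (k : NumberField.RingOfIntegers K), k ∈ v.asIdeal ↔ ‖ι.symm (w.embedding (k : K))‖ < 1) → IsCoprime (N : ℤ) (NumberField.discr K) → (∀ ℓ : ℕ, ℓ.Prime → ℓ ∣ N → ((Ideal.span {(ℓ : ℤ)}).primesOver (NumberField.RingOfIntegers K)).ncard = 2) → Odd (NumberField.discr K) → NumberField.discr K ≠ -3 → κ₁.IsCyclotomic → κ₂.IsAnticyclotomic → ∀ (Ω δ : ℂ) (Ωp : (unrIntegers p)ˣ) (LK G : PowerSeries (PowerSeries (PadicComplexInt p))), Ω ≠ 0 → (δ ^ 2 = (NumberField.discr K : ℂ) ∨ δ ^ 2 = -(NumberField.discr K : ℂ)) → IsKatzMeasure₂ ι v vbar ∅ κ₁ κ₂ γ₁⁻¹ γ₂⁻¹ 1 Ω δ ((Ωp : unrIntegers p) : PadicComplex p) LK → IsGreenbergLFunctionAnyRoot₂ ι v vbar κ₁ κ₂ γ₁⁻¹ γ₂⁻¹ f (NumberField.discr K).natAbs (NumberField.classNumber K) LK G → ∀ J : ℤ_[p] →+* PadicComplexInt p, (∀ x : ℤ_[p], ((J x :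 PadicComplexInt p) : PadicComplex p) = ((x : ℚ_[p]) : PadicComplex p)) → ((WeierstrassCurve.XGr₂.charIdeal (W.baseChange K) p κ₁ κ₂ vbar γ₁ γ₂).map (IwasawaAlgebra₂.toUnr₂ p J)).map (PowerSeries.constantCoeff (R := PowerSeries (PadicComplexInt p))) ≤ Ideal.span {UnrSeries₂.minus G}) :
    Literature.NumberTheory.EllipticCurves.ModularForms.nonempty_modularParametrizationData → ∀ (W : WeierstrassCurve ℚ) [W.IsElliptic] [W.IsGloballyMinimal] (p : ℕ) [Fact p.Prime], 5 ≤ p → Literature.NumberTheory.EllipticCurves.Rank1Residual.ClassX7 W p → Literature.NumberTheory.EllipticCurves.Rank1Residual.Surj W p → ∃ (K : Type) (_ : Field K) (_ : NumberField K) (ι : PadicAlgCl p ≃+* ℂ) (v vbar : IsDedekindDomain.HeightOneSpectrum (NumberField.RingOfIntegers K)) (κ₁ κ₂ : Literature.NumberTheory.EllipticCurves.ZpExtension K p) (γ₁ γ₂ : Field.absoluteGaloisGroup K) (_ : Fact (Literature.NumberTheory.EllipticCurves.ZpExtension.IsTopGeneratorPair κ₁ κ₂ γ₁ γ₂)) (_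 : NeZero (NumberField.discr K).natAbs) (N : ℕ) (_ : NeZero N) (f : CuspForm (CongruenceSubgroup.Gamma0 N) 2) (d : ℤ) (W' : WeierstrassCurve ℚ) (_ : W'.IsElliptic) (_ : W'.IsGloballyMinimal) (C : WeierstrassCurve.VariableChange ℚ) (N' : ℕ) (_ : NeZero N') (f' : CuspForm (CongruenceSubgroup.Gamma0 N') 2), Literature.NumberTheory.EllipticCurves.ModularForms.IsNewformOf W f ∧ (N : ℤ) = W.conductorNorm ℤ ∧ Literature.NumberTheory.EllipticCurves.ModularForms.IsNewformOf W' f' ∧ (N' : ℤ) = W'.conductorNorm ℤ ∧ Squarefree d ∧ 1 < d ∧ (∀ q : ℕ, q.Prime → Literature.NumberTheory.EllipticCurves.BurungaleSkinnerTianWan2024.RamifiedInQuadratic d q → q ≠ p ∧ ¬ q ∣ N ∧ ¬ (q : ℤ) ∣ NumberField.discr K) ∧ C • W' = W.quadraticTwist (d : ℚ) ∧ Literature.NumberTheory.EllipticCurves.IsImaginaryQuadratic K ∧ ((Ideal.span {(p : ℤ)}).primesOver (NumberField.RingOfIntegers K)).ncard = 2 ∧ ((p : ℕ) : NumberField.RingOfIntegers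 K) ∈ v.asIdeal ∧ ((p : ℕ) : NumberField.RingOfIntegers K) ∈ vbar.asIdeal ∧ vbar ≠ v ∧ (∀ (w : NumberField.InfinitePlace K) (k : NumberField.RingOfIntegers K), k ∈ v.asIdeal ↔ ‖ι.symm (w.embedding (k : K))‖ < 1) ∧ IsCoprime (N : ℤ) (NumberField.discr K) ∧ (∀ ℓ : ℕ, ℓ.Prime → ℓ ∣ N → ((Ideal.span {(ℓ : ℤ)}).primesOver (NumberField.RingOfIntegers K)).ncard = 2) ∧ (∀ ℓ : ℕ, ℓ.Prime → (ℓ : ℤ) ∣ d → ((Ideal.span {(ℓ : ℤ)}).primesOver (NumberField.RingOfIntegers K)).ncard = 2) ∧ ((Ideal.span {(2 : ℤ)}).primesOver (NumberField.RingOfIntegers K)).ncard = 2 ∧ (∀ ρ : Literature.NumberTheory.GaloisRepresentations.ModPGaloisRep K (ZMod p) 2, (W.baseChange K).IsTorsionGaloisRep p ρ → Literature.NumberTheory.GaloisRepresentations.FramedRep.IsAbsolutelyIrreducible ρ) ∧ κ₁.IsCyclotomic ∧ κ₂.IsAnticyclotomic ∧ (∃ ζ : ℤ_[p]ˣ, IsOfFinOrder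 ζ ∧ ((Literature.NumberTheory.GaloisRepresentations.GaloisRep.cyclotomicCharacter K p γ₁ * ζ : ℤ_[p]ˣ) : ℤ_[p]) = (Literature.NumberTheory.EllipticCurves.cyclotomicGenerator p : ℤ_[p])) ∧ ∀ (Ω δ : ℂ) (Ωp : (Literature.NumberTheory.EllipticCurves.unrIntegers p)ˣ) (LK G G' : PowerSeries (PowerSeries (PadicComplexInt p))), Ω ≠ 0 → (δ ^ 2 = (NumberField.discr K : ℂ) ∨ δ ^ 2 = -(NumberField.discr K : ℂ)) → Literature.NumberTheory.EllipticCurves.IsKatzMeasure₂ ι v vbar ∅ κ₁ κ₂ γ₁⁻¹ γ₂⁻¹ 1 Ω δ ((Ωp : Literature.NumberTheory.EllipticCurves.unrIntegers p) : PadicComplex p) LK → Literature.NumberTheory.EllipticCurves.IsGreenbergLFunctionAnyRoot₂ ι v vbar κ₁ κ₂ γ₁⁻¹ γ₂⁻¹ f (NumberField.discr K).natAbs (NumberField.classNumber K) LK G → Literature.NumberTheory.EllipticCurves.IsGreenbergLFunctionAnyRoot₂ ι v vbar κ₁ κ₂ γ₁⁻¹ γ₂⁻¹ f' (NumberField.discr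 K).natAbs (NumberField.classNumber K) LK G' → ∀ J : ℤ_[p] →+* PadicComplexInt p, (∀ x : ℤ_[p], ((J x : PadicComplexInt p) : PadicComplex p) = ((x : ℚ_[p]) : PadicComplex p)) → ∃ s : PowerSeries (PadicComplexInt p), s ≠ 0 ∧ Ideal.span {PowerSeries.map (PowerSeries.C (R := PadicComplexInt p)) s} * ((WeierstrassCurve.XGr₂.charIdeal (W.baseChange K) p κ₁ κ₂ vbar γ₁ γ₂).map (Literature.NumberTheory.EllipticCurves.IwasawaAlgebra₂.toUnr₂ p J) * (WeierstrassCurve.XGr₂.charIdeal (W'.baseChange K) p κ₁ κ₂ vbar γ₁ γ₂).map (Literature.NumberTheory.EllipticCurves.IwasawaAlgebra₂.toUnr₂ p J)) ≤ Ideal.span {G * G'} :=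
  twistPairGreenbergProductDivisibilityCanonical_of_eulerSystem_of_anchor hES
    (ac_of_acMu_of_acDiv (acMu_of_prop422 h422) hdiv)

end Summit.BirchSwinnertonDyer.BirchSwinnertonDyer.Theorems.SignedBaseChangeK1Acanchor

end
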